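import Literature.NumberTheory.Automorphic.CMLocalRingModulusContinuous
import Literature.NumberTheory.Automorphic.CMXiTorusCharSplitTorusDecay
import Literature.NumberTheory.Rogawski1990.KeysCaseTwoReducible
import HarnessLib

/-!
# The reparametrisation `(μ, η₁, η₂) ↦ (μ · (η₁η₂)∘(a ↦ a/ā), η₂⁻¹, η₂)` of Rogawski's case-(2) character `χ_ξ` (Rogawski 1990 §12.2)

Topic `NumberTheory/Automorphic`; namespace `Literature.NumberTheory.Automorphic.UnitaryGroup`.  THEOREMS ONLY (no definition, no named fact, no instance, no notation, no `sorry`).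
Cell `hodgecm-mathlib` (D-0151), seat B-p04 (g32); F0∕P3b desk row 2026-08-31T21:29:37Z («REPARAMETRISATION brick», second hand on the
#106 ⇐ #96 road of B-p14 (g28), FILE 3 `keysCaseTwoReducible_of_N3`); kernel lane `--supports stmt-HodgeConjecture-24833`.

THE POINT.  Rogawski's character of the diagonal torus `T` of `U(3)` attached to `ξ = (η₁, η₂)` and the `ω`-type character `μ` of `E^×` is
`χ_ξ(d(α, β, ᾱ⁻¹)) = η₁(α/ᾱ) · μ(α) · ‖α‖^{1/2} · η₂(αβᾱ⁻¹)` (★ `xiTorusChar`, ★ `cmXiTorusChar`; [Rogawski1990, §12.1 p. 171, §12.2 p. 174]: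
«`η′(a/ā) = ημ⁻¹(a)` … `ξ(h) = η′(det₀ h) χ₂(det h)`. Then `ξ` determines `χ`»).  Only the product `η̃₁ · μ` (`η̃₁(α) = η₁(α/ᾱ)`) enters the
first coordinate, so the triple `(μ, η₁, η₂)` and the triple `(μ · (η₁η₂)~, η₂⁻¹, η₂)` give THE SAME character of `T`:
`η₂⁻¹(α/ᾱ) · (μ(α) η₁(α/ᾱ) η₂(α/ᾱ)) = η₁(α/ᾱ) · μ(α)`.  The new `μ`-slot `μ · (η₁η₂)~` is again of `ω`-type (on `σ`-fixed units `a/ā = 1`,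
★ `quotConj_eq_one_of_map_eq`) and continuous when `μ, η₁, η₂` are (★ `continuous_quotConj`, ★ `continuous_conjLocal`).  CONSEQUENCE
(`UnitaryGroup.keysCaseTwoReducible_of_thetaShape`): the letter N4 ★ `Rogawski1990.KeysCaseTwoReducible L` — reducibility of `i_G(χ_ξ)` for
EVERY `ω`-type continuous `μ` and ALL continuous `η₁, η₂` — follows from its «theta-shaped» special case `(μ, ψ⁻¹, ψ)` (the shape in which the
theta-type constituent of [GelbartRogawski1991, §5] is produced by the tree: ★ `stubThetaInPS_of_N3`, ★ `F0P2oLineWeilCMMultiplicityOne`), because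
`χ_{(μ, η₁, η₂)} = χ_{(μ·(η₁η₂)~, η₂⁻¹, η₂)}` literally.  HONEST LABEL: HC_CM is proved only modulo the printed citations until rung 0 closes; this
file is unconditional bookkeeping and discharges no letter by itself.

## Mathlib / tree search
★ `xiTorusChar_apply` ∕ `cmXiTorusChar` (`UnitaryGroupBorelInduction`), ★ `quotConj_eq_one_of_map_eq` (`CMXiTorusCharSplitTorusDecay`),
★ `continuous_quotConj` (`CMLocalRingModulusContinuous`), ★ `continuous_conjLocal` (`UnitaryGroupLocalFactors`), ★ `Rogawski1990.KeysCaseTwoReducible`.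
`lean search 'xiTorusChar.*η₂⁻¹|reparam.*TorusChar|keysCaseTwoReducible_of'` = 0 hits (2026-08-31T21:40Z).

## References
* [Rogawski1990] J. D. Rogawski, *Automorphic Representations of Unitary Groups in Three Variables*, Ann. of Math. Stud. 123 (1990),
  §12.1 pp. 171–172, §12.2 (2) pp. 173–174.
* [Keys1984] D. Keys, *Principal series representations of special unitary groups over local fields*, Compositio Math. 51 (1984), §7 Thm. (2).
* [GelbartRogawski1991] S. Gelbart, J. Rogawski, *L-functions and Fourier–Jacobi coefficients for the unitary group U(3)*, Invent. Math.
  105 (1991), §5.2 p. 467.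
-/

set_option autoImplicit false

noncomputable section

open NumberField IsDedekindDomain

namespace Literature.NumberTheory.Automorphic.UnitaryGroup

/-! ## §1 Generic: the first coordinate of `χ_ξ` only sees `η̃₁ · μ` -/

section Generic

variable {R : Type*} [CommRing R] (σ : R →+* R) {N : ℕ} (J : Matrix (Fin N) (Fin N) R)

/-- **`χ_{(μ, η₁, η₂)} = χ_{(μ · (η₁η₂)~, η₂⁻¹, η₂)}`** as characters of the diagonal torus of `U(σ, Φ_N)(R)` (★ `xiTorusChar`): both sides are
`t ↦ η₁(t_i/σ t_i) · μ(t_i) · ‖t_i‖^{1/2} · η₂(det t)`, since `η₂⁻¹(q) · η₁(q) η₂(q) = η₁(q)` at `q = t_i/σ(t_i)` («`ξ` determines `χ`» — only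
`η′ = η̃₁μ` enters). [cite: Rogawski1990, §12.2 p. 174; §12.1 p. 171] -/
theorem xiTorusChar_reparam [TopologicalSpace R] [IsTopologicalRing R] [LocallyCompactSpace R]
    (hJ : J = (StdForm.antidiagonal N).over R) (hσ : ∀ x : R, σ (σ x) = x) (i : Fin N) (μ : Rˣ →* ℂˣ)
    (η₁ η₂ : ↥(normOneUnits σ) →* ℂˣ) :
    xiTorusChar σ J hJ hσ i μ η₁ η₂ = xiTorusChar σ J hJ hσ i (μ * (η₁ * η₂).comp (quotConj σ hσ)) η₂⁻¹ η₂ := by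
  refine MonoidHom.ext fun t => ?_
  rw [xiTorusChar_apply, xiTorusChar_apply]
  simp only [MonoidHom.mul_apply, MonoidHom.inv_apply, MonoidHom.comp_apply]
  set q := quotConj σ hσ (torusEntry σ J i t)
  set a := torusEntry σ J i t
  calc η₁ q * μ a * halfModulusChar R a * η₂ (torusDetNormOne σ J hJ t)
      = ((η₂ q)⁻¹ * η₂ q) * (η₁ q * μ a) * halfModulusChar R a * η₂ (torusDetNormOne σ J hJ t) := by
        rw [inv_mul_cancel, one_mul]
    _ = (η₂ q)⁻¹ * (μ a * (η₁ q * η₂ q)) * halfModulusChar R a * η₂ (torusDetNormOne σ J hJ t) := by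
        congr 2
        rw [mul_assoc, mul_comm (η₂ q) (η₁ q * μ a), mul_assoc, mul_comm (μ a) (η₂ q), ← mul_assoc (η₁ q),
          mul_comm (η₁ q * η₂ q) (μ a)]

/-- **The new `μ`-slot is again of `ω`-type**: for a character `η` of `E¹`, `μ · (η ∘ (a ↦ a/σ a))` agrees with `μ` on the `σ`-fixed units
(`a/σ(a) = 1` there, ★ `quotConj_eq_one_of_map_eq`), so «`μ|F^× = ω_{E/F}`» (★ `IsQuadraticCharExtension`) holds for one iff for the other.
[cite: Rogawski1990, §12.2 p. 173; §4.8 p. 51] -/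
theorem isQuadraticCharExtension_mul_comp_quotConj_iff (hσ : ∀ x : R, σ (σ x) = x) (μ : Rˣ →* ℂˣ)
    (η : ↥(normOneUnits σ) →* ℂˣ) :
    IsQuadraticCharExtension σ (μ * η.comp (quotConj σ hσ)) ↔ IsQuadraticCharExtension σ μ := by
  refine forall₂_congr fun x hx => ?_
  rw [MonoidHom.mul_apply, MonoidHom.comp_apply, quotConj_eq_one_of_map_eq σ hσ x hx, map_one, mul_one]

/-- **Continuity of the new `μ`-slot**: `x ↦ μ(x) · η(x/σ x) ∈ ℂ` is continuous on `R^×` when `μ`, `η` and the involution `σ` are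
(★ `continuous_quotConj`). [cite: Rogawski1990, §12.1 p. 172] -/
theorem continuous_mul_comp_quotConj_apply [TopologicalSpace R] [IsTopologicalRing R] (hσ : ∀ x : R, σ (σ x) = x)
    (hσc : Continuous σ) (μ : Rˣ →* ℂˣ) (η : ↥(normOneUnits σ) →* ℂˣ) (hμc : Continuous fun x => ((μ x : ℂˣ) : ℂ))
    (hηc : Continuous fun z => ((η z : ℂˣ) : ℂ)) :
    Continuous fun x => (((μ * η.comp (quotConj σ hσ)) x : ℂˣ) : ℂ) := by
  have hq : Continuous (quotConj σ hσ) := continuous_quotConj σ hσ hσc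
  simp only [MonoidHom.mul_apply, MonoidHom.comp_apply, Units.val_mul]
  exact hμc.mul (hηc.comp hq)

end Generic

/-! ## §2 The CM instance `U(Φ₃)(L⁺_v)`: `cmXiTorusChar L v μ η₁ η₂ = cmXiTorusChar L v (μ · (η₁η₂)~) η₂⁻¹ η₂` -/

section CM

variable (L : Type) [Field L] [NumberField L] [IsCMField L] (v : HeightOneSpectrum (𝓞 ↥(maximalRealSubfield L)))

/-- **`χ_{(μ, η₁, η₂)} = χ_{(μ·(η₁η₂)~, η₂⁻¹, η₂)}` on the torus of `U(Φ₃)(L⁺_v)`** (★ `cmXiTorusChar`, coordinate `i = 0`).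
[cite: Rogawski1990, §12.2 p. 174] -/
theorem cmXiTorusChar_reparam (μ : (LocalRing L v)ˣ →* ℂˣ)
    (η₁ η₂ : ↥(normOneUnits (conjLocal L (IsCMField.complexConj L) v)) →* ℂˣ) :
    cmXiTorusChar L v μ η₁ η₂ =
      cmXiTorusChar L v (μ * (η₁ * η₂).comp (quotConj (conjLocal L (IsCMField.complexConj L) v) (conjLocal_conjLocal_cm L v)))
        η₂⁻¹ η₂ :=
  xiTorusChar_reparam _ _ (cmLocalForm_eq_over L 3 v) (conjLocal_conjLocal_cm L v) 0 μ η₁ η₂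

/-- **Reducibility transports along an equality of torus characters**: «`i_G(χ)` has a proper non-zero `G`-stable subspace» for `χ′`
gives the same for `χ` when `χ = χ′` (the two principal series ★ `cmPrincipalSeries` are the same representation; `subst`, no unfolding).
[cite: Rogawski1990, §12.2 (2) pp. 173–174] -/
theorem exists_subrepresentation_cmPrincipalSeries_congr
    {χ χ' : ↥(torusU (conjLocal L (IsCMField.complexConj L) v) (cmLocalForm L 3 v)) →* ℂˣ} (e : χ = χ')
    (h : ∃ N : Subrepresentation (cmPrincipalSeries L 3 v χ'), N ≠ ⊥ ∧ N ≠ ⊤) :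
    ∃ N : Subrepresentation (cmPrincipalSeries L 3 v χ), N ≠ ⊥ ∧ N ≠ ⊤ := by
  subst e
  exact h

/-- **Reducibility transports along the reparametrisation**: a proper non-zero `G`-stable subspace of `i_G(χ)` for the triple
`(μ·(η₁η₂)~, η₂⁻¹, η₂)` IS one for `(μ, η₁, η₂)` (★ `cmXiTorusChar_reparam`). [cite: Rogawski1990, §12.2 (2) pp. 173–174] -/
theorem exists_subrepresentation_cmPrincipalSeries_of_reparam (μ : (LocalRing L v)ˣ →* ℂˣ)
    (η₁ η₂ : ↥(normOneUnits (conjLocal L (IsCMField.complexConj L) v)) →* ℂˣ)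
    (h : ∃ N : Subrepresentation (cmPrincipalSeries L 3 v (cmXiTorusChar L v
        (μ * (η₁ * η₂).comp (quotConj (conjLocal L (IsCMField.complexConj L) v) (conjLocal_conjLocal_cm L v))) η₂⁻¹ η₂)),
        N ≠ ⊥ ∧ N ≠ ⊤) :
    ∃ N : Subrepresentation (cmPrincipalSeries L 3 v (cmXiTorusChar L v μ η₁ η₂)), N ≠ ⊥ ∧ N ≠ ⊤ :=
  exists_subrepresentation_cmPrincipalSeries_congr L v (cmXiTorusChar_reparam L v μ η₁ η₂) h

/-- **The same identity in the `(χ₁, χ₂)`-pair currency** (★ `cmTorusCharPair`, ★ `cmXiTorusChar_eq_cmTorusCharPair` is `rfl`):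
`(η₂⁻¹~ · (μ·(η₁η₂)~) · ‖·‖^{1/2}, η₂) = χ_{(μ, η₁, η₂)}` — the shape in which a reducibility statement typed for general pairs
(★ `U3PrincipalSeriesJacquetFiltration` currency) at the theta-shaped triple reads on the original triple. [cite: Rogawski1990, §12.2 p. 174] -/
theorem cmTorusCharPair_reparam_eq_cmXiTorusChar (μ : (LocalRing L v)ˣ →* ℂˣ)
    (η₁ η₂ : ↥(normOneUnits (conjLocal L (IsCMField.complexConj L) v)) →* ℂˣ) :
    cmTorusCharPair L v
        (η₂⁻¹.comp (quotConj (conjLocal L (IsCMField.complexConj L) v) (conjLocal_conjLocal_cm L v)) *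
            (μ * (η₁ * η₂).comp (quotConj (conjLocal L (IsCMField.complexConj L) v) (conjLocal_conjLocal_cm L v))) *
          halfModulusChar (LocalRing L v)) η₂ =
      cmXiTorusChar L v μ η₁ η₂ :=
  ((cmXiTorusChar_eq_cmTorusCharPair L v _ η₂⁻¹ η₂).symm).trans (cmXiTorusChar_reparam L v μ η₁ η₂).symm

/-- **Reducibility transports, pair currency**: `∃ N` for `i_G((η₂⁻¹~ · (μ·(η₁η₂)~) · ‖·‖^{1/2}, η₂))` gives `∃ N` for `i_G(χ_{(μ, η₁, η₂)})`.
[cite: Rogawski1990, §12.2 (2) pp. 173–174] -/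
theorem exists_subrepresentation_cmPrincipalSeries_of_reparam_pair (μ : (LocalRing L v)ˣ →* ℂˣ)
    (η₁ η₂ : ↥(normOneUnits (conjLocal L (IsCMField.complexConj L) v)) →* ℂˣ)
    (h : ∃ N : Subrepresentation (cmPrincipalSeries L 3 v (cmTorusCharPair L v
        (η₂⁻¹.comp (quotConj (conjLocal L (IsCMField.complexConj L) v) (conjLocal_conjLocal_cm L v)) *
            (μ * (η₁ * η₂).comp (quotConj (conjLocal L (IsCMField.complexConj L) v) (conjLocal_conjLocal_cm L v))) *
          halfModulusChar (LocalRing L v)) η₂)),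
        N ≠ ⊥ ∧ N ≠ ⊤) :
    ∃ N : Subrepresentation (cmPrincipalSeries L 3 v (cmXiTorusChar L v μ η₁ η₂)), N ≠ ⊥ ∧ N ≠ ⊤ :=
  exists_subrepresentation_cmPrincipalSeries_congr L v (cmTorusCharPair_reparam_eq_cmXiTorusChar L v μ η₁ η₂).symm h

/-- The new `μ`-slot at the CM place is of `ω`-type iff the old one is. [cite: Rogawski1990, §12.2 p. 173] -/
theorem isQuadraticCharExtension_cm_reparam_iff (μ : (LocalRing L v)ˣ →* ℂˣ)
    (η : ↥(normOneUnits (conjLocal L (IsCMField.complexConj L) v)) →* ℂˣ) :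
    IsQuadraticCharExtension (conjLocal L (IsCMField.complexConj L) v)
        (μ * η.comp (quotConj (conjLocal L (IsCMField.complexConj L) v) (conjLocal_conjLocal_cm L v))) ↔
      IsQuadraticCharExtension (conjLocal L (IsCMField.complexConj L) v) μ :=
  isQuadraticCharExtension_mul_comp_quotConj_iff _ (conjLocal_conjLocal_cm L v) μ η

/-- The new `μ`-slot at the CM place is continuous when `μ` and `η` are (★ `continuous_conjLocal`). [cite: Rogawski1990, §12.1 p. 172] -/
theorem continuous_cm_reparam_apply (μ : (LocalRing L v)ˣ →* ℂˣ)
    (η : ↥(normOneUnits (conjLocal L (IsCMField.complexConj L) v)) →* ℂˣ) (hμc : Continuous fun x => ((μ x : ℂˣ) : ℂ))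
    (hηc : Continuous fun z => ((η z : ℂˣ) : ℂ)) :
    Continuous fun x => (((μ * η.comp (quotConj (conjLocal L (IsCMField.complexConj L) v) (conjLocal_conjLocal_cm L v))) x : ℂˣ) : ℂ) :=
  continuous_mul_comp_quotConj_apply _ (conjLocal_conjLocal_cm L v) (continuous_conjLocal L (IsCMField.complexConj L) v) μ η hμc hηc

/-! ## §3 The letter N4 from its theta-shaped special case -/

set_option synthInstance.maxHeartbeats 400000 in
set_option maxHeartbeats 4000000 in  -- instance-path unification of `∃ N : Subrepresentation (cmPrincipalSeries …), N ≠ ⊥ ∧ N ≠ ⊤` with the letter's own elaboration (★ `KeysCaseTwoReducible.lean` context) costs ≈ 10⁶ beats, as in ★ `F0P3KeysCaseTwoOfStubs` §4 (< 60 s wall)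
/-- **N4 `KeysCaseTwoReducible L` FROM ITS THETA-SHAPED CASE `(μ, ψ⁻¹, ψ)`**: if at every non-split `v`, for every `ω`-type continuous `μ` and
every continuous character `ψ` of `E¹_v` the principal series `i_G(χ_{(μ, ψ⁻¹, ψ)})` is reducible, then `i_G(χ_{(μ′, η₁, η₂)})` is reducible for
EVERY admissible triple — apply the hypothesis at `(μ′·(η₁η₂)~, η₂)` (again `ω`-type and continuous, §1–§2) and transport along
★ `cmXiTorusChar_reparam`.  This is the reduction through which the #106 ⇐ #96 road (theta-type constituent with one-dimensional Jacquet
module inside a length-two principal series) reaches the letter as typed. [cite: Rogawski1990, §12.2 (2) pp. 173–174]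
[cite: Keys1984, §7 Theorem (2) p. 126] [cite: GelbartRogawski1991, §5.2 p. 467] -/
theorem keysCaseTwoReducible_of_thetaShape
    (h : ∀ (v : HeightOneSpectrum (𝓞 ↥(maximalRealSubfield L))),
      (∀ w : UnitaryGroup.PlacesOver L v, IsCMField.complexConj L • w.1 = w.1) →
      ∀ (μ : (UnitaryGroup.LocalRing L v)ˣ →* ℂˣ)
        (ψ : ↥(UnitaryGroup.normOneUnits (UnitaryGroup.conjLocal L (IsCMField.complexConj L) v)) →* ℂˣ),
        UnitaryGroup.IsQuadraticCharExtension (UnitaryGroup.conjLocal L (IsCMField.complexConj L) v) μ →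
        Continuous (fun x => ((μ x : ℂˣ) : ℂ)) → Continuous (fun x => ((ψ x : ℂˣ) : ℂ)) →
      ∃ N : Subrepresentation (UnitaryGroup.cmPrincipalSeries L 3 v (UnitaryGroup.cmXiTorusChar L v μ ψ⁻¹ ψ)), N ≠ ⊥ ∧ N ≠ ⊤) :
    Rogawski1990.KeysCaseTwoReducible L :=
  fun v hns μ η₁ η₂ hμ hμc h1c h2c =>
    exists_subrepresentation_cmPrincipalSeries_of_reparam L v μ η₁ η₂
      (h v hns (μ * (η₁ * η₂).comp (UnitaryGroup.quotConj (UnitaryGroup.conjLocal L (IsCMField.complexConj L) v)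
          (UnitaryGroup.conjLocal_conjLocal_cm L v))) η₂
        ((isQuadraticCharExtension_cm_reparam_iff L v μ (η₁ * η₂)).2 hμ)
        (continuous_cm_reparam_apply L v μ (η₁ * η₂) hμc (by
          simp only [MonoidHom.mul_apply, Units.val_mul]
          exact h1c.mul h2c))
        h2c)

end CM

end Literature.NumberTheory.Automorphic.UnitaryGroup

end
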